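import Summits.HodgeConjecture.CorCM.IrreducibleOddWeightsShadowIdealsCriterion
import Summits.HodgeConjecture.CorCM.IrreducibleOddWeightsOrbitBalanceCMFields
import HarnessLib

/-!
# Shadow ideals, VII: the PIVOT-FREE criterion — two slots are additive iff no `G`-INVARIANT KERNELS
# `k₀ : E₁ × E₀ → ℚ`, `k₁ : E₁ × E₁ → ℚ` have `k₀·u₀ = k₁·u₁ ≠ 0`; any two CM fields, any two types

COR-CM (cell `pub-hodgecm2`, binder seat `b16` gen 63, count-neutral claim SHADOW IDEALS, file S7 — abstract `G`-set level
and CM fields; theorems only, no definition, no named fact, no `sorry`).  NEW as stated, hence under `Summits/`.  HONEST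
FRAMING: finite-dimensional linear algebra about `dim MT(A₀ × A₁)` for two abelian varieties with complex multiplication
and about which Hodge classes on `A₀^a × A₁^b` are sums of products; `HC_CM` is neither used nor asserted.

Files S1–S6 reduced the pair `{Φ_{i₀}, Φ_{i₁}}` to a common Galois PIVOT `M` below both fields containing `L₀ ∩ L₁`.  Such a
pivot need not exist (a non-normal partner `K₁ ↪ K₀`: gen 62's last open item).  It is not needed: the slot `E_{i₁}`
itself serves, once maps BETWEEN the two permutation modules are admitted.

* §1 **`IrrOdd.typeRank_sigmaType_add_card_eq_iff_not_exists_collision`** (ANY two `G`-sets `E_{i₀}`, `E_{i₁}`, CM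
  types for `ρ`): `rank(Φ₀, Φ₁) + 2 = rank Φ₀ + rank Φ₁ + 1` (`Hg(A₀ × A₁) = Hg(A₀) × Hg(A₁)`) **iff there are NO
  `G`-equivariant linear `α : ℚ^{E_{i₀}} → ℚ^{E_{i₁}}`, `β : ℚ^{E_{i₁}} → ℚ^{E_{i₁}}` with `α(u₀) = β(u₁) ≠ 0`.**
  (⟸ the collision lemma; ⟹ the evaluation criterion gives a collision `T₀ u₀ = −T₁ u₁ ≠ 0` in an irreducible `V`, which
  receives the non-zero `T₁` from `ℚ^{E_{i₁}}` and therefore EMBEDS equivariantly into `ℚ^{E_{i₁}}` — S2's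
  `exists_equivariant_injective_of_irreducible`; compose.)
* §2 **`IrrOdd.typeRank_sigmaType_add_card_eq_iff_not_exists_invariant_kernels`** — the same in coordinates: equivariant
  linear maps between permutation modules are exactly the `G`-INVARIANT KERNELS `k(g x₁, g x₀) = k(x₁, x₀)`
  (`apply_eq_sum_kernel`, `kernel_invariant_of_equivariant`, `exists_linearMap_of_invariant_kernel`), i.e. functions of the
  `G`-orbit of the pair `(x₁, x₀)`; additive **iff no invariant `k₀` on `E_{i₁} × E_{i₀}` and `k₁` on `E_{i₁} × E_{i₁}` have
  `Σ_{x₀} k₀(·, x₀) u₀(x₀) = Σ_{x₁'} k₁(·, x₁') u₁(x₁') ≠ 0`.**  Gen 49's PARALLEL SHADOWS is `k₀ = [r x₀ = x₁]`,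
  `k₁ = q·[x₁ = x₁']`; S3's Hecke criterion is the case where both kernels factor through a torsor.
* §3 CM fields (`G = Aut(ℂ)`, `E_i = Hom(K_i, ℂ)`; an invariant kernel on `Hom(K₁, ℂ) × Hom(K₀, ℂ)` is a function of the
  `Aut(ℂ)`-orbit of the pair, i.e. of the factor of `K₁ ⊗_ℚ K₀` it selects — finitely many integers):
  **`cmFamilyRank_add_card_eq_pair_iff_not_exists_invariant_kernels`** — for ANY two CM fields and ANY two types,
  `Hg(A₀ × A₁) = Hg(A₀) × Hg(A₁)` iff no `Aut(ℂ)`-invariant rational kernels `k₀, k₁` have `k₀·u₀ = k₁·u₁ ≠ 0`;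
  unconditional half `cmFamilyRank_add_card_lt_of_invariant_kernels`; realisations
  `forall_hodgeClassesProductSpan_pair_iff_not_exists_invariant_kernels`, `exists_not_hodgeClassesProductSpan_pair_of_invariant_kernels`.

## References

* [Gordon1999HodgeAVSurvey] B. B. Gordon, *A survey of the Hodge conjecture for abelian varieties*, §3 Theorem (Imai,
  Murty) with proof, 7.5–7.7.
* [Mai1989] L. Mai, *Lower bounds for the ranks of CM types*, J. Number Theory 32 (1989), §2 Prop. 1 (proof).
* [Serre1977] J.-P. Serre, *Linear Representations of Finite Groups*, GTM 42, §2.2 Prop. 4; §7 Ex. 7.2 (permutation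
  representations and invariant kernels).
* [MoonenZarhin1999LowDim] B. Moonen, Yu. Zarhin, Math. Ann. 315 (1999), Thm. (0.1) (a), §3 (3.1).
* [Deligne1982HodgeCycles] P. Deligne, *Hodge cycles on abelian varieties*, LNM 900 (1982), I Ex. 3.7.
-/

set_option autoImplicit false

noncomputable section

open scoped BigOperators

universe u v w

namespace Summit.HodgeConjecture.CorCM

namespace IrrOdd

open Literature.NumberTheory.ComplexMultiplication

variable {G : Type w} [Group G]

/-! ### §1 The pivot-free collision criterion -/

section Collision

variable {I : Type u} {E : I → Type v} [∀ i, MulAction G (E i)] [DecidableEq I] [Fintype I] [∀ i, Fintype (E i)]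

/-- **NO COLLISION BETWEEN THE TWO PERMUTATION MODULES ⟹ ADDITIVE.**  Two-slot family `{i₀, i₁}`; if no `G`-equivariant
`α : ℚ^{E_{i₀}} → ℚ^{E_{i₁}}`, `β ∈ End(ℚ^{E_{i₁}})` have `α(u_1(Φ_{i₀})) = β(u_1(Φ_{i₁})) ≠ 0`, then `ext_i U(Φ_i) ≤ U(Σ)`
for both slots.  (A collision in an irreducible `V` receiving `T₁ ≠ 0` from `ℚ^{E_{i₁}}` transfers into `ℚ^{E_{i₁}}` along an
equivariant embedding `V ↪ ℚ^{E_{i₁}}`.) [cite: Mai1989, §2 Prop. 1 (proof)] [cite: Serre1977, §2.2 Prop. 4] -/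
theorem forall_map_slotExt_le_of_not_exists_collision {Φ : ∀ i, Set (E i)} {i₀ i₁ : I} (hI : ∀ j, j = i₀ ∨ j = i₁)
    (h01 : i₀ ≠ i₁)
    (hno : ¬ ∃ (α : (E i₀ → ℚ) →ₗ[ℚ] (E i₁ → ℚ)) (β : (E i₁ → ℚ) →ₗ[ℚ] (E i₁ → ℚ)),
      (∀ (g : G) (f : E i₀ → ℚ), α (fun x => f (g⁻¹ • x)) = fun y => α f (g⁻¹ • y)) ∧
      (∀ (g : G) (f : E i₁ → ℚ), β (fun x => f (g⁻¹ • x)) = fun y => β f (g⁻¹ • y)) ∧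
      α (antiVec (Φ i₀) (1 : G)) = β (antiVec (Φ i₁) (1 : G)) ∧ α (antiVec (Φ i₀) (1 : G)) ≠ 0) :
    ∀ i, (antiSpan G (Φ i)).map (slotExt i) ≤ antiSpan G (sigmaType Φ) := by
  classical
  refine forall_map_slotExt_le_of_forall_irreducible Φ fun V _ _ _ π hπ T hT hsum => ?_
  have hsum2 : T i₀ (antiVec (Φ i₀) (1 : G)) + T i₁ (antiVec (Φ i₁) (1 : G)) = 0 := by
    rw [Fintype.sum_eq_add i₀ i₁ h01 (fun j hj => ?_)] at hsum
    · exact hsum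
    · rcases hI j with rfl | rfl
      · exact absurd rfl hj.1
      · exact absurd rfl hj.2
  suffices h0 : T i₀ (antiVec (Φ i₀) (1 : G)) = 0 by
    intro i
    rcases hI i with rfl | rfl
    · exact h0
    · rw [h0, zero_add] at hsum2
      exact hsum2
  by_contra hv
  have hv1 : T i₁ (antiVec (Φ i₁) (1 : G)) ≠ 0 := fun h1 => hv (by rw [h1, add_zero] at hsum2; exact hsum2)
  have hT₁ : T i₁ ≠ 0 := fun h0 => hv1 (by rw [h0, LinearMap.zero_apply])
  obtain ⟨ι, hιinj, hι⟩ := exists_equivariant_injective_of_irreducible π hπ (T i₁) (hT i₁) hT₁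
  refine hno ⟨ι ∘ₗ T i₀, -(ι ∘ₗ T i₁), fun g f => ?_, fun g f => ?_, ?_, ?_⟩
  · rw [LinearMap.comp_apply, LinearMap.comp_apply, hT i₀, hι]
  · rw [LinearMap.neg_apply, LinearMap.neg_apply, LinearMap.comp_apply, LinearMap.comp_apply, hT i₁, hι]
    funext y
    rfl
  · rw [LinearMap.neg_apply, LinearMap.comp_apply, LinearMap.comp_apply, ← map_neg,
      eq_neg_of_add_eq_zero_left hsum2]
  · rw [LinearMap.comp_apply]
    exact fun h0 => hv (hιinj (by rw [h0, map_zero]))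

variable [Nonempty I] [∀ i, Nonempty (E i)]

/-- **THE PIVOT-FREE CRITERION.**  Any two `G`-sets, any two CM types for `ρ`: `rank(Φ₀, Φ₁) + 2 = rank Φ₀ + rank Φ₁ + 1`
(`Hg(A₀ × A₁) = Hg(A₀) × Hg(A₁)`) **iff NO `G`-equivariant `α : ℚ^{E_{i₀}} → ℚ^{E_{i₁}}`, `β : ℚ^{E_{i₁}} → ℚ^{E_{i₁}}` have
`α(u₀) = β(u₁) ≠ 0`.** [cite: Gordon1999HodgeAVSurvey, §3 Theorem (proof) and 7.5–7.7] [cite: Mai1989, §2 Prop. 1 (proof)] -/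
theorem typeRank_sigmaType_add_card_eq_iff_not_exists_collision {ρ : G} {Φ : ∀ i, Set (E i)}
    (h : ∀ i, IsCMTypeWith ρ (Φ i)) {i₀ i₁ : I} (hI : ∀ j, j = i₀ ∨ j = i₁) (h01 : i₀ ≠ i₁) :
    typeRank G (sigmaType Φ) + Fintype.card I = (∑ i, typeRank G (Φ i)) + 1 ↔
      ¬ ∃ (α : (E i₀ → ℚ) →ₗ[ℚ] (E i₁ → ℚ)) (β : (E i₁ → ℚ) →ₗ[ℚ] (E i₁ → ℚ)),
        (∀ (g : G) (f : E i₀ → ℚ), α (fun x => f (g⁻¹ • x)) = fun y => α f (g⁻¹ • y)) ∧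
        (∀ (g : G) (f : E i₁ → ℚ), β (fun x => f (g⁻¹ • x)) = fun y => β f (g⁻¹ • y)) ∧
        α (antiVec (Φ i₀) (1 : G)) = β (antiVec (Φ i₁) (1 : G)) ∧ α (antiVec (Φ i₀) (1 : G)) ≠ 0 := by
  refine ⟨fun hEq => ?_, fun hno =>
    typeRank_sigmaType_add_card_eq_of_forall_map_le h (forall_map_slotExt_le_of_not_exists_collision hI h01 hno)⟩
  rintro ⟨α, β, hα, hβ, heq, hne⟩
  exact absurd hEq (ne_of_lt (typeRank_sigmaType_add_card_lt_of_eval_eq h h01 (fun g (f : E i₁ → ℚ) y => f (g⁻¹ • y))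
    α β hα hβ heq hne))

end Collision

/-! ### §2 Equivariant maps between permutation modules are invariant kernels -/

section Kernels

variable {X₀ : Type v} {X₁ : Type v} [MulAction G X₀] [MulAction G X₁] [Fintype X₀] [DecidableEq X₀]

omit [MulAction G X₀] in
/-- A linear map out of `ℚ^{X₀}` is integration against its kernel `k(x₁, x₀) = α(δ_{x₀})(x₁)`. [folklore] -/
theorem apply_eq_sum_kernel (α : (X₀ → ℚ) →ₗ[ℚ] (X₁ → ℚ)) (f : X₀ → ℚ) (x₁ : X₁) :
    α f x₁ = ∑ x₀, α (Pi.single x₀ 1) x₁ * f x₀ := by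
  have hdec : ∀ x, (Pi.single x (f x) : X₀ → ℚ) = f x • (Pi.single x 1 : X₀ → ℚ) := fun x => by
    funext z
    simp only [Pi.single_apply, Pi.smul_apply, smul_eq_mul, mul_ite, mul_one, mul_zero]
  conv_lhs => rw [← Finset.univ_sum_single f]
  rw [map_sum, Finset.sum_apply]
  refine Finset.sum_congr rfl fun x _ => ?_
  rw [hdec, map_smul, Pi.smul_apply, smul_eq_mul, mul_comm]

omit [Fintype X₀] in
/-- The kernel of an EQUIVARIANT map is INVARIANT: `k(g x₁, g x₀) = k(x₁, x₀)`. [cite: Serre1977, §7 Ex. 7.2] -/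
theorem kernel_invariant_of_equivariant (α : (X₀ → ℚ) →ₗ[ℚ] (X₁ → ℚ))
    (hα : ∀ (g : G) (f : X₀ → ℚ), α (fun x => f (g⁻¹ • x)) = fun y => α f (g⁻¹ • y)) (g : G) (x₁ : X₁) (x₀ : X₀) :
    α (Pi.single (g • x₀) 1) (g • x₁) = α (Pi.single x₀ 1) x₁ := by
  rw [← single_comp_inv_smul g x₀ 1, hα g]
  change α (Pi.single x₀ 1) (g⁻¹ • g • x₁) = _
  rw [inv_smul_smul]

omit [DecidableEq X₀] in
/-- **An INVARIANT kernel integrates to an EQUIVARIANT map** `f ↦ (x₁ ↦ Σ_{x₀} k(x₁, x₀) f(x₀))`.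
[cite: Serre1977, §7 Ex. 7.2] -/
theorem exists_linearMap_of_invariant_kernel (k : X₁ → X₀ → ℚ)
    (hk : ∀ (g : G) (x₁ : X₁) (x₀ : X₀), k (g • x₁) (g • x₀) = k x₁ x₀) :
    ∃ α : (X₀ → ℚ) →ₗ[ℚ] (X₁ → ℚ), (∀ f, α f = fun x₁ => ∑ x₀, k x₁ x₀ * f x₀) ∧
      ∀ (g : G) (f : X₀ → ℚ), α (fun x => f (g⁻¹ • x)) = fun y => α f (g⁻¹ • y) := by
  refine ⟨{ toFun := fun f x₁ => ∑ x₀, k x₁ x₀ * f x₀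
            map_add' := fun f f' => by
              funext x₁
              simp only [Pi.add_apply, mul_add, Finset.sum_add_distrib]
            map_smul' := fun c f => by
              funext x₁
              simp only [Pi.smul_apply, smul_eq_mul, RingHom.id_apply, Finset.mul_sum, mul_left_comm] },
    fun f => rfl, fun g f => ?_⟩
  funext x₁
  change ∑ x₀, k x₁ x₀ * f (g⁻¹ • x₀) = ∑ x₀, k (g⁻¹ • x₁) x₀ * f x₀
  rw [← Fintype.sum_equiv (MulAction.toPerm g) (fun x₀ => k x₁ (g • x₀) * f x₀)
    (fun x₀ => k x₁ x₀ * f (g⁻¹ • x₀)) (fun x₀ => by simp only [MulAction.toPerm_apply, inv_smul_smul])]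
  refine Finset.sum_congr rfl fun x₀ _ => ?_
  rw [← hk g (g⁻¹ • x₁) x₀, smul_inv_smul]

/-- **Equivariant maps `ℚ^{X₀} → ℚ^{X₁}` and invariant kernels produce the same vectors `α(u)`.**
[cite: Serre1977, §7 Ex. 7.2] -/
theorem exists_equivariant_apply_eq_iff_exists_invariant_kernel (u : X₀ → ℚ)
    (w : X₁ → ℚ) :
    (∃ α : (X₀ → ℚ) →ₗ[ℚ] (X₁ → ℚ),
        (∀ (g : G) (f : X₀ → ℚ), α (fun x => f (g⁻¹ • x)) = fun y => α f (g⁻¹ • y)) ∧ α u = w) ↔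
      ∃ k : X₁ → X₀ → ℚ, (∀ (g : G) (x₁ : X₁) (x₀ : X₀), k (g • x₁) (g • x₀) = k x₁ x₀) ∧
        (fun x₁ => ∑ x₀, k x₁ x₀ * u x₀) = w := by
  constructor
  · rintro ⟨α, hα, rfl⟩
    refine ⟨fun x₁ x₀ => α (Pi.single x₀ 1) x₁, fun g x₁ x₀ => kernel_invariant_of_equivariant α hα g x₁ x₀, ?_⟩
    funext x₁
    exact (apply_eq_sum_kernel α u x₁).symm
  · rintro ⟨k, hk, rfl⟩
    obtain ⟨α, hαk, hα⟩ := exists_linearMap_of_invariant_kernel (G := G) k hk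
    exact ⟨α, hα, hαk u⟩

end Kernels

section KernelCriterion

variable {I : Type u} {E : I → Type v} [∀ i, MulAction G (E i)] [DecidableEq I] [Fintype I] [∀ i, Fintype (E i)]
  [Nonempty I] [∀ i, Nonempty (E i)]

/-- **THE INVARIANT-KERNEL CRITERION.**  Any two `G`-sets `E_{i₀}`, `E_{i₁}`, CM types `Φ_i` for `ρ`, `u_κ = u_1(Φ_{i_κ})`:
`rank(Φ₀, Φ₁) + 2 = rank Φ₀ + rank Φ₁ + 1` (`Hg(A₀ × A₁) = Hg(A₀) × Hg(A₁)`) **iff there are NO `G`-invariant kernels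
`k₀ : E_{i₁} × E_{i₀} → ℚ`, `k₁ : E_{i₁} × E_{i₁} → ℚ` (functions of the `G`-orbit of the pair) with
`Σ_{x₀} k₀(x₁, x₀) u₀(x₀) = Σ_{x₁'} k₁(x₁, x₁') u₁(x₁')` for all `x₁` and not identically zero.**
[cite: Gordon1999HodgeAVSurvey, §3 Theorem (proof) and 7.5–7.7] [cite: Serre1977, §7 Ex. 7.2] -/
theorem typeRank_sigmaType_add_card_eq_iff_not_exists_invariant_kernels {ρ : G} {Φ : ∀ i, Set (E i)}
    (h : ∀ i, IsCMTypeWith ρ (Φ i)) {i₀ i₁ : I} (hI : ∀ j, j = i₀ ∨ j = i₁) (h01 : i₀ ≠ i₁) :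
    typeRank G (sigmaType Φ) + Fintype.card I = (∑ i, typeRank G (Φ i)) + 1 ↔
      ¬ ∃ (k₀ : E i₁ → E i₀ → ℚ) (k₁ : E i₁ → E i₁ → ℚ),
        (∀ (g : G) (x₁ : E i₁) (x₀ : E i₀), k₀ (g • x₁) (g • x₀) = k₀ x₁ x₀) ∧
        (∀ (g : G) (x₁ x₁' : E i₁), k₁ (g • x₁) (g • x₁') = k₁ x₁ x₁') ∧
        (fun x₁ => ∑ x₀, k₀ x₁ x₀ * antiVec (Φ i₀) (1 : G) x₀) =
          (fun x₁ => ∑ x₁', k₁ x₁ x₁' * antiVec (Φ i₁) (1 : G) x₁') ∧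
        (fun x₁ => ∑ x₀, k₀ x₁ x₀ * antiVec (Φ i₀) (1 : G) x₀) ≠ 0 := by
  classical
  rw [typeRank_sigmaType_add_card_eq_iff_not_exists_collision h hI h01, not_iff_not]
  constructor
  · rintro ⟨α, β, hα, hβ, heq, hne⟩
    obtain ⟨k₀, hk₀, hk₀w⟩ := (exists_equivariant_apply_eq_iff_exists_invariant_kernel (G := G)
      (antiVec (Φ i₀) (1 : G)) (α (antiVec (Φ i₀) (1 : G)))).1 ⟨α, hα, rfl⟩
    obtain ⟨k₁, hk₁, hk₁w⟩ := (exists_equivariant_apply_eq_iff_exists_invariant_kernel (G := G)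
      (antiVec (Φ i₁) (1 : G)) (β (antiVec (Φ i₁) (1 : G)))).1 ⟨β, hβ, rfl⟩
    refine ⟨k₀, k₁, hk₀, hk₁, ?_, ?_⟩
    · rw [hk₀w, hk₁w, heq]
    · rw [hk₀w]
      exact hne
  · rintro ⟨k₀, k₁, hk₀, hk₁, heq, hne⟩
    obtain ⟨α, hα, hαw⟩ := (exists_equivariant_apply_eq_iff_exists_invariant_kernel (G := G)
      (antiVec (Φ i₀) (1 : G)) _).2 ⟨k₀, hk₀, rfl⟩
    obtain ⟨β, hβ, hβw⟩ := (exists_equivariant_apply_eq_iff_exists_invariant_kernel (G := G)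
      (antiVec (Φ i₁) (1 : G)) _).2 ⟨k₁, hk₁, rfl⟩
    refine ⟨α, β, hα, hβ, ?_, ?_⟩
    · rw [hαw, hβw, heq]
    · rw [hαw]
      exact hne

/-- **Unconditional half in kernel form**: invariant kernels with `k₀·u₀ = k₁·u₁ ≠ 0` force
`rank(Σ) + |I| < Σ_i rank(Φ_i) + 1`. [cite: Gordon1999HodgeAVSurvey, §3 Theorem (proof) and 7.5] -/
theorem typeRank_sigmaType_add_card_lt_of_invariant_kernels {ρ : G} {Φ : ∀ i, Set (E i)}
    (h : ∀ i, IsCMTypeWith ρ (Φ i)) {i₀ i₁ : I} (h01 : i₀ ≠ i₁) (k₀ : E i₁ → E i₀ → ℚ) (k₁ : E i₁ → E i₁ → ℚ)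
    (hk₀ : ∀ (g : G) (x₁ : E i₁) (x₀ : E i₀), k₀ (g • x₁) (g • x₀) = k₀ x₁ x₀)
    (hk₁ : ∀ (g : G) (x₁ x₁' : E i₁), k₁ (g • x₁) (g • x₁') = k₁ x₁ x₁')
    (heq : (fun x₁ => ∑ x₀, k₀ x₁ x₀ * antiVec (Φ i₀) (1 : G) x₀) =
      fun x₁ => ∑ x₁', k₁ x₁ x₁' * antiVec (Φ i₁) (1 : G) x₁')
    (hne : (fun x₁ => ∑ x₀, k₀ x₁ x₀ * antiVec (Φ i₀) (1 : G) x₀) ≠ 0) :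
    typeRank G (sigmaType Φ) + Fintype.card I < (∑ i, typeRank G (Φ i)) + 1 := by
  classical
  obtain ⟨α, hα, hαw⟩ := (exists_equivariant_apply_eq_iff_exists_invariant_kernel (G := G)
    (antiVec (Φ i₀) (1 : G)) _).2 ⟨k₀, hk₀, rfl⟩
  obtain ⟨β, hβ, hβw⟩ := (exists_equivariant_apply_eq_iff_exists_invariant_kernel (G := G)
    (antiVec (Φ i₁) (1 : G)) _).2 ⟨k₁, hk₁, rfl⟩
  exact typeRank_sigmaType_add_card_lt_of_eval_eq h h01 (fun g (f : E i₁ → ℚ) y => f (g⁻¹ • y)) α β hα hβ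
    (by rw [hαw, hβw, heq]) (by rw [hαw]; exact hne)

end KernelCriterion

end IrrOdd

/-! ### §3 Any two CM fields -/

section CM

open scoped Classical

open CategoryTheory CategoryTheory.Limits NumberField Module IntermediateField
open Literature.NumberTheory.ComplexMultiplication
open Literature.AlgebraicGeometry.Motives (AbelianVariety CMType)
open Literature.AlgebraicGeometry.Motives.AbelianVariety
open Literature.AlgebraicGeometry.HodgeTheory
open Literature.AlgebraicGeometry.ComplexMultiplication (IsCMTypeRealisation)
open Literature.AlgebraicGeometry.Pohlmann1968

variable {I : Type} [Fintype I] {K : I → Type} [∀ i, Field (K i)] [∀ i, NumberField (K i)] [∀ i, IsCMField (K i)]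

/-- **INVARIANT KERNELS WITH `k₀·u₀ = k₁·u₁ ≠ 0` OBSTRUCT `Hg(A₀ × A₁) = Hg(A₀) × Hg(A₁)`** (any two CM fields, any types).
[cite: Gordon1999HodgeAVSurvey, §3 Theorem (proof) and 7.5] -/
theorem cmFamilyRank_add_card_lt_of_invariant_kernels {i₀ i₁ : I} (h01 : i₀ ≠ i₁) (Φ : ∀ i, CMType (K i))
    (k₀ : (K i₁ →+* ℂ) → (K i₀ →+* ℂ) → ℚ) (k₁ : (K i₁ →+* ℂ) → (K i₁ →+* ℂ) → ℚ)
    (hk₀ : ∀ (g : ℂ ≃+* ℂ) (x₁ : K i₁ →+* ℂ) (x₀ : K i₀ →+* ℂ), k₀ (g • x₁) (g • x₀) = k₀ x₁ x₀)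
    (hk₁ : ∀ (g : ℂ ≃+* ℂ) (x₁ x₁' : K i₁ →+* ℂ), k₁ (g • x₁) (g • x₁') = k₁ x₁ x₁')
    (heq : (fun x₁ => ∑ x₀, k₀ x₁ x₀ * antiVec (Φ i₀).1 (1 : ℂ ≃+* ℂ) x₀) =
      fun x₁ => ∑ x₁', k₁ x₁ x₁' * antiVec (Φ i₁).1 (1 : ℂ ≃+* ℂ) x₁')
    (hne : (fun x₁ => ∑ x₀, k₀ x₁ x₀ * antiVec (Φ i₀).1 (1 : ℂ ≃+* ℂ) x₀) ≠ 0) :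
    CMAlgebra.cmFamilyRank Φ + Fintype.card I < (∑ i, cmTypeRank (Φ i)) + 1 := by
  haveI : Nonempty I := ⟨i₀⟩
  haveI : ∀ i, Nonempty (K i →+* ℂ) := fun i => inferInstance
  exact IrrOdd.typeRank_sigmaType_add_card_lt_of_invariant_kernels (G := ℂ ≃+* ℂ) (E := fun i => K i →+* ℂ)
    (Φ := fun i => (Φ i).1) (fun i => isCMTypeWith_conj (Φ i)) h01 k₀ k₁ hk₀ hk₁ heq hne

/-- **THE INVARIANT-KERNEL CRITERION FOR ANY TWO CM FIELDS.**  Two-slot family `{i₀, i₁}`, CM fields `K_{i₀}`, `K_{i₁}`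
(no relation assumed), types `Φ_i`, `u_κ = 2·𝟙_{Φ_{i_κ}} − 1` on `Hom(K_{i_κ}, ℂ)`.  Then `Hg(A₀ × A₁) = Hg(A₀) × Hg(A₁)`
(`cmFamilyRank Φ + 2 = cmTypeRank Φ₀ + cmTypeRank Φ₁ + 1`) **iff there are NO `Aut(ℂ)`-invariant rational kernels
`k₀` on `Hom(K_{i₁},ℂ) × Hom(K_{i₀},ℂ)`, `k₁` on `Hom(K_{i₁},ℂ)²` with `Σ_{x₀} k₀(·,x₀)u₀(x₀) = Σ_{x₁'} k₁(·,x₁')u₁(x₁') ≠ 0`**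
(an invariant kernel is a function of the `Aut(ℂ)`-orbit of the pair of embeddings, i.e. of the factor of the tensor
product of the two fields it selects).  No pivot, no Galois hypothesis.
[cite: Gordon1999HodgeAVSurvey, §3 Theorem (proof), 7.5–7.7] [cite: Mai1989, §2 Prop. 1 (proof)] [cite: Serre1977, §7 Ex. 7.2] -/
theorem cmFamilyRank_add_card_eq_pair_iff_not_exists_invariant_kernels {i₀ i₁ : I} (h01 : i₀ ≠ i₁)
    (hI : ∀ l, l = i₀ ∨ l = i₁) (Φ : ∀ i, CMType (K i)) :
    CMAlgebra.cmFamilyRank Φ + Fintype.card I = (∑ i, cmTypeRank (Φ i)) + 1 ↔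
      ¬ ∃ (k₀ : (K i₁ →+* ℂ) → (K i₀ →+* ℂ) → ℚ) (k₁ : (K i₁ →+* ℂ) → (K i₁ →+* ℂ) → ℚ),
        (∀ (g : ℂ ≃+* ℂ) (x₁ : K i₁ →+* ℂ) (x₀ : K i₀ →+* ℂ), k₀ (g • x₁) (g • x₀) = k₀ x₁ x₀) ∧
        (∀ (g : ℂ ≃+* ℂ) (x₁ x₁' : K i₁ →+* ℂ), k₁ (g • x₁) (g • x₁') = k₁ x₁ x₁') ∧
        (fun x₁ => ∑ x₀, k₀ x₁ x₀ * antiVec (Φ i₀).1 (1 : ℂ ≃+* ℂ) x₀) =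
          (fun x₁ => ∑ x₁', k₁ x₁ x₁' * antiVec (Φ i₁).1 (1 : ℂ ≃+* ℂ) x₁') ∧
        (fun x₁ => ∑ x₀, k₀ x₁ x₀ * antiVec (Φ i₀).1 (1 : ℂ ≃+* ℂ) x₀) ≠ 0 := by
  haveI : Nonempty I := ⟨i₀⟩
  haveI : ∀ i, Nonempty (K i →+* ℂ) := fun i => inferInstance
  exact IrrOdd.typeRank_sigmaType_add_card_eq_iff_not_exists_invariant_kernels (G := ℂ ≃+* ℂ)
    (E := fun i => K i →+* ℂ) (Φ := fun i => (Φ i).1) (fun i => isCMTypeWith_conj (Φ i)) hI h01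

variable {Φ : ∀ i, CMType (K i)} {A : I → AbelianVariety ℂ} {ιA : ∀ i, 𝓞 (K i) →+* End (A i)}
  {θ : ∀ i, K i →+* Module.End ℂ (complexBetti (A i).X 1)}

/-- **EVERY HODGE CLASS ON EVERY `A₀^a × A₁^b` IS A SUM OF PRODUCTS ⟺ NO INVARIANT KERNELS COLLIDE THE TYPE VECTORS**
(any two CM abelian varieties `A_i ⊨ (K_i; Φ_i)`; disjoint slot maps). [cite: MoonenZarhin1999LowDim, §3 (3.1)]
[cite: Gordon1999HodgeAVSurvey, 7.5–7.7] -/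
theorem forall_hodgeClassesProductSpan_pair_iff_not_exists_invariant_kernels {i₀ i₁ : I} (h01 : i₀ ≠ i₁)
    (hI : ∀ l, l = i₀ ∨ l = i₁) (hA : ∀ i, IsCMTypeRealisation (Φ i) (A i) (ιA i) (θ i)) :
    (∀ (N₁ N₂ : ℕ) [NeZero N₁] [NeZero N₂] (π₁ : Fin N₁ → I) (π₂ : Fin N₂ → I), (∀ l₁ l₂, π₁ l₁ ≠ π₂ l₂) →
        HodgeClassesProductSpan (⨁ fun l => A (π₁ l)) (⨁ fun l => A (π₂ l))) ↔
      ¬ ∃ (k₀ : (K i₁ →+* ℂ) → (K i₀ →+* ℂ) → ℚ) (k₁ : (K i₁ →+* ℂ) → (K i₁ →+* ℂ) → ℚ),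
        (∀ (g : ℂ ≃+* ℂ) (x₁ : K i₁ →+* ℂ) (x₀ : K i₀ →+* ℂ), k₀ (g • x₁) (g • x₀) = k₀ x₁ x₀) ∧
        (∀ (g : ℂ ≃+* ℂ) (x₁ x₁' : K i₁ →+* ℂ), k₁ (g • x₁) (g • x₁') = k₁ x₁ x₁') ∧
        (fun x₁ => ∑ x₀, k₀ x₁ x₀ * antiVec (Φ i₀).1 (1 : ℂ ≃+* ℂ) x₀) =
          (fun x₁ => ∑ x₁', k₁ x₁ x₁' * antiVec (Φ i₁).1 (1 : ℂ ≃+* ℂ) x₁') ∧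
        (fun x₁ => ∑ x₀, k₀ x₁ x₀ * antiVec (Φ i₀).1 (1 : ℂ ≃+* ℂ) x₀) ≠ 0 := by
  haveI : Nonempty I := ⟨i₀⟩
  exact (cmFamilyRank_add_card_eq_iff_forall_hodgeClassesProductSpan hA).symm.trans
    (cmFamilyRank_add_card_eq_pair_iff_not_exists_invariant_kernels h01 hI Φ)

/-- **Invariant kernels with `k₀·u₀ = k₁·u₁ ≠ 0` ⟹ a MIXED exceptional Hodge class** on some
`(⨁_l A_{π₁ l}) × (⨁_l A_{π₂ l})` with disjoint slot maps. [cite: MoonenZarhin1999LowDim, Thm. (0.1) (a)]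
[cite: Gordon1999HodgeAVSurvey, 7.5] -/
theorem exists_not_hodgeClassesProductSpan_pair_of_invariant_kernels {i₀ i₁ : I} (h01 : i₀ ≠ i₁)
    (hA : ∀ i, IsCMTypeRealisation (Φ i) (A i) (ιA i) (θ i))
    (k₀ : (K i₁ →+* ℂ) → (K i₀ →+* ℂ) → ℚ) (k₁ : (K i₁ →+* ℂ) → (K i₁ →+* ℂ) → ℚ)
    (hk₀ : ∀ (g : ℂ ≃+* ℂ) (x₁ : K i₁ →+* ℂ) (x₀ : K i₀ →+* ℂ), k₀ (g • x₁) (g • x₀) = k₀ x₁ x₀)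
    (hk₁ : ∀ (g : ℂ ≃+* ℂ) (x₁ x₁' : K i₁ →+* ℂ), k₁ (g • x₁) (g • x₁') = k₁ x₁ x₁')
    (heq : (fun x₁ => ∑ x₀, k₀ x₁ x₀ * antiVec (Φ i₀).1 (1 : ℂ ≃+* ℂ) x₀) =
      fun x₁ => ∑ x₁', k₁ x₁ x₁' * antiVec (Φ i₁).1 (1 : ℂ ≃+* ℂ) x₁')
    (hne : (fun x₁ => ∑ x₀, k₀ x₁ x₀ * antiVec (Φ i₀).1 (1 : ℂ ≃+* ℂ) x₀) ≠ 0) :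
    ∃ (N₁ N₂ : ℕ) (_ : NeZero N₁) (_ : NeZero N₂) (π₁ : Fin N₁ → I) (π₂ : Fin N₂ → I),
      (∀ l₁ l₂, π₁ l₁ ≠ π₂ l₂) ∧ ¬ HodgeClassesProductSpan (⨁ fun l => A (π₁ l)) (⨁ fun l => A (π₂ l)) := by
  haveI : Nonempty I := ⟨i₀⟩
  exact exists_not_hodgeClassesProductSpan_of_cmFamilyRank_add_card_ne hA
    (ne_of_lt (cmFamilyRank_add_card_lt_of_invariant_kernels h01 Φ k₀ k₁ hk₀ hk₁ heq hne))

end CM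

end Summit.HodgeConjecture.CorCM

end
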